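import Mathlib.Analysis.Complex.ReImTopology
import Mathlib.Analysis.Complex.Convex
import Mathlib.Analysis.SpecialFunctions.Trigonometric.Bounds
import Literature.Topology.PlaneTopology.AnnulusFaces
import HarnessLib

/-!
# Open rectangles and polar rectangles as Jordan domains

Topic: Topology / PlaneTopology. Two explicit families of Jordan domains with their boundary
loops (used as supports of handle-straightening moves in the smoothing of topological surfaces,
`Literature/Topology/FourManifolds/PlanarSmoothStructures.lean`):

* `rect a b c d` (`a < b`, `c < d`) — the open axis-parallel rectangle
  `(a, b) ×ℂ (c, d) = {a < re z < b, c < im z < d}` with boundary loop the four sides run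
  counter-clockwise from the corner `a + ci` (`quadLoop` of four affine segments; frontier from
  Mathlib's `Complex.frontier_reProdIm`);
* `polarRect r₁ r₂ θ₁ θ₂` (`0 < r₁ < r₂`, `θ₁ < θ₂ < θ₁ + 1`) — the open polar rectangle
  `{r e^{2πiθ} : r₁ < r < r₂, θ₁ < θ < θ₂}`, the image of `rect (log r₁) (log r₂) (2πθ₁) (2πθ₂)`
  under `exp`, which is injective on the closed rectangle since its height is `< 2π`
  (`JordanDomain.image`, `ImageUnivalent.lean`); its carrier and closure are described in polar
  form (`mem_polarRect_carrier_iff`, `mem_closure_polarRect_carrier_iff`).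

All folklore; everything proved.
-/

noncomputable section

namespace Literature.Topology.PlaneTopology

open Set Metric Real Filter _root_.Topology Bornology Complex
open Literature.Probability.RandomPlanarGeometry (JordanDomain)
open Literature.Probability.RandomPlanarGeometry.JordanDomain

/-! ### Affine segments -/

/-- The affine segment from `p` to `q`: `u ↦ p + u (q - p)`. [folklore] -/
def seg (p q : ℂ) (u : ℝ) : ℂ := p + (u : ℂ) * (q - p)

/-- The segment map is continuous. [folklore] -/
@[fun_prop] theorem continuous_seg (p q : ℂ) : Continuous (seg p q) := by unfold seg; fun_prop

/-- The segment starts at `p`. [folklore] -/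
@[simp] theorem seg_zero (p q : ℂ) : seg p q 0 = p := by simp [seg]

/-- The segment ends at `q`. [folklore] -/
@[simp] theorem seg_one (p q : ℂ) : seg p q 1 = q := by simp [seg]

/-- The segment map is injective for `p ≠ q`. [folklore] -/
theorem injective_seg {p q : ℂ} (h : p ≠ q) : Function.Injective (seg p q) := fun u v huv => by
  simp only [seg, add_right_inj] at huv
  have := mul_right_cancel₀ (sub_ne_zero.2 h.symm) huv
  exact_mod_cast this

/-- Real and imaginary parts along a segment. [folklore] -/
theorem seg_re_im (p q : ℂ) (u : ℝ) : (seg p q u).re = p.re + u * (q.re - p.re) ∧ (seg p q u).im = p.im + u * (q.im - p.im) := by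
  simp [seg]

/-- A horizontal segment `[x₁ + yi, x₂ + yi]` (`x₁ ≤ x₂`) traces `[x₁, x₂] ×ℂ {y}`. [folklore] -/
theorem image_seg_horizontal {x₁ x₂ y : ℝ} (h : x₁ ≤ x₂) :
    seg (x₁ + y * I) (x₂ + y * I) '' Icc 0 1 = Icc x₁ x₂ ×ℂ {y} := by
  ext z
  simp only [mem_image, mem_reProdIm, mem_singleton_iff]
  constructor
  · rintro ⟨u, hu, rfl⟩
    obtain ⟨hre, him⟩ := seg_re_im (x₁ + y * I) (x₂ + y * I) u
    simp only [add_re, ofReal_re, mul_re, I_re, mul_zero, ofReal_im, I_im, mul_one, sub_self, add_zero,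
      add_im, mul_im, zero_add] at hre him
    rw [hre, him]
    exact ⟨⟨by nlinarith [hu.1], by nlinarith [hu.2]⟩, by ring⟩
  · rintro ⟨hz, hzi⟩
    rcases eq_or_lt_of_le h with heq | hlt
    · refine ⟨0, by norm_num, ?_⟩
      apply Complex.ext <;> simp [seg, hzi]
      linarith [hz.1, hz.2]
    · set u : ℝ := (z.re - x₁) / (x₂ - x₁) with hu_def
      refine ⟨u, ⟨div_nonneg (by linarith [hz.1]) (by linarith),
        (div_le_one (by linarith)).2 (by linarith [hz.2])⟩, ?_⟩
      obtain ⟨hre, him⟩ := seg_re_im (x₁ + y * I) (x₂ + y * I) u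
      simp only [add_re, ofReal_re, mul_re, I_re, mul_zero, ofReal_im, I_im, mul_one, sub_self, add_zero,
        add_im, mul_im, zero_add] at hre him
      have hx : x₂ - x₁ ≠ 0 := by linarith
      apply Complex.ext
      · rw [hre, hu_def]; field_simp; ring
      · rw [him, hzi]

/-- A vertical segment `[x + y₁ i, x + y₂ i]` (`y₁ ≤ y₂`) traces `{x} ×ℂ [y₁, y₂]`. [folklore] -/
theorem image_seg_vertical {x y₁ y₂ : ℝ} (h : y₁ ≤ y₂) :
    seg (x + y₁ * I) (x + y₂ * I) '' Icc 0 1 = {x} ×ℂ Icc y₁ y₂ := by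
  ext z
  simp only [mem_image, mem_reProdIm, mem_singleton_iff]
  constructor
  · rintro ⟨u, hu, rfl⟩
    obtain ⟨hre, him⟩ := seg_re_im (x + y₁ * I) (x + y₂ * I) u
    simp only [add_re, ofReal_re, mul_re, I_re, mul_zero, ofReal_im, I_im, mul_one, sub_self, add_zero,
      add_im, mul_im, zero_add] at hre him
    rw [hre, him]
    exact ⟨by ring, by nlinarith [hu.1], by nlinarith [hu.2]⟩
  · rintro ⟨hzr, hz⟩
    rcases eq_or_lt_of_le h with heq | hlt
    · refine ⟨0, by norm_num, ?_⟩
      apply Complex.ext <;> simp [seg, hzr]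
      linarith [hz.1, hz.2]
    · set u : ℝ := (z.im - y₁) / (y₂ - y₁) with hu_def
      refine ⟨u, ⟨div_nonneg (by linarith [hz.1]) (by linarith),
        (div_le_one (by linarith)).2 (by linarith [hz.2])⟩, ?_⟩
      obtain ⟨hre, him⟩ := seg_re_im (x + y₁ * I) (x + y₂ * I) u
      simp only [add_re, ofReal_re, mul_re, I_re, mul_zero, ofReal_im, I_im, mul_one, sub_self, add_zero,
        add_im, mul_im, zero_add] at hre him
      have hy : y₂ - y₁ ≠ 0 := by linarith
      apply Complex.ext
      · rw [hre, hzr]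
      · rw [him, hu_def]; field_simp; ring

/-- The image of `[0, 1]` under the reversed segment is the same set. [folklore] -/
theorem image_seg_symm (p q : ℂ) : seg q p '' Icc 0 1 = seg p q '' Icc 0 1 := by
  have key : ∀ p q : ℂ, seg q p '' Icc 0 1 ⊆ seg p q '' Icc 0 1 := by
    intro p q
    rintro _ ⟨u, hu, rfl⟩
    refine ⟨1 - u, ⟨by linarith [hu.2], by linarith [hu.1]⟩, ?_⟩
    simp only [seg]; push_cast; ring
  exact (key p q).antisymm (key q p)

/-! ### The open rectangle -/

section Rect

variable {a b c d : ℝ} (hab : a < b) (hcd : c < d)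

/-- The four corners of the rectangle, counter-clockwise from bottom-left. [folklore] -/
def rectCorner (a b c d : ℝ) : Fin 4 → ℂ := ![a + c * I, b + c * I, b + d * I, a + d * I]

include hab hcd in
/-- **The open rectangle `(a,b) ×ℂ (c,d)` as a Jordan domain**, boundary loop the four sides run
counter-clockwise from `a + ci` at quarter parameters. [folklore] -/
def rect : JordanDomain where
  carrier := Ioo a b ×ℂ Ioo c d
  boundary := quadLoop (seg (a + c * I) (b + c * I)) (seg (b + c * I) (b + d * I)) (seg (b + d * I) (a + d * I))
    (seg (a + d * I) (a + c * I))
  isOpen := isOpen_Ioo.reProdIm isOpen_Ioo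
  isBounded := (isBounded_Ioo a b).reProdIm (isBounded_Ioo c d)
  isConnected := by
    refine ⟨⟨((a + b) / 2 : ℝ) + ((c + d) / 2 : ℝ) * I, ?_⟩, ?_⟩
    · simp only [mem_reProdIm, add_re, ofReal_re, mul_re, I_re, mul_zero, ofReal_im, I_im, mul_one, sub_self,
        add_zero, add_im, mul_im, zero_add, mem_Ioo]
      exact ⟨⟨by linarith, by linarith⟩, by linarith, by linarith⟩
    · -- convex, as the intersection of four open half-planes
      have hconv : Convex ℝ (Ioo a b ×ℂ Ioo c d) := by
        have : Ioo a b ×ℂ Ioo c d = {z : ℂ | a < z.re} ∩ {z | z.re < b} ∩ ({z | c < z.im} ∩ {z | z.im < d}) := by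
          ext z; simp only [mem_reProdIm, mem_Ioo, mem_inter_iff, mem_setOf_eq, and_assoc]
        rw [this]
        exact ((convex_halfSpace_re_gt a).inter (convex_halfSpace_re_lt b)).inter
          ((convex_halfSpace_im_gt c).inter (convex_halfSpace_im_lt d))
      exact hconv.isPreconnected
  continuous_boundary := continuous_quadLoop ⟨by simp, by simp, by simp, by simp⟩ (continuous_seg _ _)
    (continuous_seg _ _) (continuous_seg _ _) (continuous_seg _ _)
  periodic_boundary := periodic_quadLoop
  injOn_boundary := by
    have hbc : (b : ℂ) + c * I ≠ a + c * I := fun h => by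
      have := congrArg Complex.re h; simp at this; linarith
    have hj : QuadJunction (seg (a + c * I) (b + c * I)) (seg (b + c * I) (b + d * I)) (seg (b + d * I) (a + d * I))
        (seg (a + d * I) (a + c * I)) := ⟨by simp, by simp, by simp, by simp⟩
    refine injOn_quadLoop hj (injective_seg ?_).injOn (injective_seg ?_).injOn (injective_seg ?_).injOn
      (injective_seg ?_).injOn ?_ ?_ ?_ ?_ ?_ ?_
    · intro h; have := congrArg Complex.re h; simp at this; linarith
    · intro h; have := congrArg Complex.im h; simp at this; linarith
    · intro h; have := congrArg Complex.re h; simp at this; linarith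
    · intro h; have := congrArg Complex.im h; simp at this; linarith
    · -- bottom ∩ right ⊆ {b + ci}
      rw [image_seg_horizontal hab.le, image_seg_vertical hcd.le, seg_zero]
      rintro z ⟨⟨-, hzi⟩, hzr, -⟩
      simp only [mem_preimage, mem_singleton_iff] at hzi hzr ⊢
      apply Complex.ext <;> simp [hzi, hzr]
    · -- right ∩ top ⊆ {b + di}
      rw [image_seg_vertical hcd.le, image_seg_symm, image_seg_horizontal hab.le, seg_zero]
      rintro z ⟨⟨hzr, -⟩, -, hzi⟩
      simp only [mem_preimage, mem_singleton_iff] at hzi hzr ⊢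
      apply Complex.ext <;> simp [hzi, hzr]
    · -- top ∩ left ⊆ {a + di}
      rw [image_seg_symm, image_seg_horizontal hab.le, image_seg_symm, image_seg_vertical hcd.le, seg_zero]
      rintro z ⟨⟨-, hzi⟩, hzr, -⟩
      simp only [mem_preimage, mem_singleton_iff] at hzi hzr ⊢
      apply Complex.ext <;> simp [hzi, hzr]
    · -- left ∩ bottom ⊆ {a + ci}
      rw [image_seg_symm, image_seg_vertical hcd.le, image_seg_horizontal hab.le, seg_zero]
      rintro z ⟨⟨hzr, -⟩, -, hzi⟩
      simp only [mem_preimage, mem_singleton_iff] at hzi hzr ⊢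
      apply Complex.ext <;> simp [hzi, hzr]
    · -- bottom ∩ top = ∅
      rw [image_seg_horizontal hab.le, image_seg_symm, image_seg_horizontal hab.le, Set.disjoint_left]
      rintro z ⟨-, hz⟩ ⟨-, hz'⟩
      simp only [mem_preimage, mem_singleton_iff] at hz hz'
      linarith
    · -- right ∩ left = ∅
      rw [image_seg_vertical hcd.le, image_seg_symm, image_seg_vertical hcd.le, Set.disjoint_left]
      rintro z ⟨hz, -⟩ ⟨hz', -⟩
      simp only [mem_preimage, mem_singleton_iff] at hz hz'
      linarith
  range_boundary := by
    rw [range_quadLoop ⟨by simp, by simp, by simp, by simp⟩, image_seg_horizontal hab.le, image_seg_vertical hcd.le,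
      image_seg_symm, image_seg_horizontal hab.le, image_seg_symm, image_seg_vertical hcd.le,
      frontier_reProdIm, closure_Ioo hab.ne, closure_Ioo hcd.ne, frontier_Ioo hab, frontier_Ioo hcd]
    ext z
    simp only [mem_union, mem_reProdIm, mem_insert_iff, mem_singleton_iff]
    tauto

/-- The carrier of the open rectangle. [folklore] -/
@[simp] theorem rect_carrier : (rect hab hcd).carrier = Ioo a b ×ℂ Ioo c d := rfl

/-- The closure of the open rectangle is the closed rectangle. [folklore] -/
theorem closure_rect_carrier : closure (rect hab hcd).carrier = Icc a b ×ℂ Icc c d := by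
  rw [rect_carrier, closure_reProdIm, closure_Ioo hab.ne, closure_Ioo hcd.ne]

end Rect

/-! ### Polar rectangles -/

section Polar

variable {r₁ r₂ θ₁ θ₂ : ℝ} (hr₁ : 0 < r₁) (hr : r₁ < r₂) (hθ : θ₁ < θ₂) (hθ' : θ₂ < θ₁ + 1)

include hr₁ hr in
/-- `log r₁ < log r₂`. [folklore] -/
theorem log_lt_log_of_radii : Real.log r₁ < Real.log r₂ := Real.log_lt_log hr₁ hr

include hθ in
/-- `2πθ₁ < 2πθ₂`. [folklore] -/
theorem two_pi_mul_lt : 2 * π * θ₁ < 2 * π * θ₂ := by nlinarith [pi_pos]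

/-- `exp (x + yi)` in polar form: norm `e^x`, and `exp (x + 2πθ i) = e^x · e^{2πθi}`. [folklore] -/
theorem exp_eq_polar (z : ℂ) : Complex.exp z = Real.exp z.re * Complex.exp (z.im * I) := by
  conv_lhs => rw [← re_add_im z, Complex.exp_add]
  push_cast
  ring_nf

include hθ' in
/-- **`exp` is injective on the closed rectangle of height `< 2π`.** [folklore] -/
theorem injOn_exp_closedRect : InjOn Complex.exp (Icc (Real.log r₁) (Real.log r₂) ×ℂ Icc (2 * π * θ₁) (2 * π * θ₂)) := by
  intro z hz w hw h
  obtain ⟨n, hn⟩ := Complex.exp_eq_exp_iff_exists_int.1 h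
  have him := congrArg Complex.im hn
  simp only [add_im, mul_im, intCast_re, mul_re, re_ofNat, ofReal_re, im_ofNat, ofReal_im, mul_zero, sub_zero,
    I_re, zero_mul, add_zero, I_im, mul_one, intCast_im] at him
  -- `z.im = w.im + n 2π` with both in an interval of length `< 2π` forces `n = 0`
  rw [mem_reProdIm] at hz hw
  have h1 : |z.im - w.im| < 2 * π := by
    rw [abs_lt]; constructor <;> nlinarith [hz.2.1, hz.2.2, hw.2.1, hw.2.2, pi_pos]
  have hn0 : n = 0 := by
    have h2 : |(n : ℝ)| * (2 * π) < 2 * π := by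
      have : z.im - w.im = n * (2 * π) := by linarith
      rw [this, abs_mul, abs_of_pos (by positivity : (0 : ℝ) < 2 * π)] at h1
      exact h1
    have h3 : |(n : ℝ)| < 1 := by
      by_contra hle; push Not at hle
      nlinarith [pi_pos]
    have h4 : |n| < 1 := by exact_mod_cast h3
    rw [abs_lt] at h4
    omega
  subst hn0
  simpa using hn

include hθ' in
/-- `exp` is injective on the closure of the rectangle `(log r₁, log r₂) ×ℂ (2πθ₁, 2πθ₂)`.
[folklore] -/
theorem injOn_exp_closure_rect (hab : Real.log r₁ < Real.log r₂) (hcd : 2 * π * θ₁ < 2 * π * θ₂) :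
    InjOn Complex.exp (closure (rect hab hcd).carrier) := by
  rw [closure_rect_carrier]; exact injOn_exp_closedRect hθ'

include hr₁ hr hθ hθ' in
/-- **The open polar rectangle `{r e^{2πiθ} : r₁ < r < r₂, θ₁ < θ < θ₂}` as a Jordan domain**:
the image of the rectangle `(log r₁, log r₂) ×ℂ (2πθ₁, 2πθ₂)` under `exp`. [folklore] -/
def polarRect : JordanDomain :=
  (rect (log_lt_log_of_radii hr₁ hr) (two_pi_mul_lt hθ)).image Complex.exp Complex.continuous_exp.continuousOn
    (injOn_exp_closure_rect hθ' _ _)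

/-- The carrier of the polar rectangle is the `exp`-image of the open rectangle. [folklore] -/
theorem polarRect_carrier : (polarRect hr₁ hr hθ hθ').carrier =
    Complex.exp '' (Ioo (Real.log r₁) (Real.log r₂) ×ℂ Ioo (2 * π * θ₁) (2 * π * θ₂)) := rfl

/-- The closure of the polar rectangle is the `exp`-image of the closed rectangle. [folklore] -/
theorem closure_polarRect_carrier : closure (polarRect hr₁ hr hθ hθ').carrier =
    Complex.exp '' (Icc (Real.log r₁) (Real.log r₂) ×ℂ Icc (2 * π * θ₁) (2 * π * θ₂)) := by
  rw [polarRect, closure_carrier_image, closure_rect_carrier]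

/-- **Polar description of the carrier**: `z ∈ polarRect` iff `z = r e^{2πiθ}` with
`r₁ < r < r₂`, `θ₁ < θ < θ₂`. [folklore] -/
theorem mem_polarRect_carrier_iff {z : ℂ} : z ∈ (polarRect hr₁ hr hθ hθ').carrier ↔
    ∃ r ∈ Ioo r₁ r₂, ∃ θ ∈ Ioo θ₁ θ₂, z = (r : ℂ) * Complex.exp (2 * π * θ * I) := by
  rw [polarRect_carrier]
  constructor
  · rintro ⟨w, hw, rfl⟩
    rw [mem_reProdIm] at hw
    refine ⟨Real.exp w.re, ⟨?_, ?_⟩, w.im / (2 * π), ⟨?_, ?_⟩, ?_⟩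
    · calc r₁ = Real.exp (Real.log r₁) := (Real.exp_log hr₁).symm
        _ < Real.exp w.re := Real.exp_lt_exp.2 hw.1.1
    · calc Real.exp w.re < Real.exp (Real.log r₂) := Real.exp_lt_exp.2 hw.1.2
        _ = r₂ := Real.exp_log (hr₁.trans hr)
    · rw [lt_div_iff₀ (by positivity)]; linarith [hw.2.1]
    · rw [div_lt_iff₀ (by positivity)]; linarith [hw.2.2]
    · rw [exp_eq_polar]
      congr 2
      push_cast; field_simp
  · rintro ⟨r, hrr, θ, hθθ, rfl⟩
    refine ⟨Real.log r + 2 * π * θ * I, ?_, ?_⟩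
    · rw [mem_reProdIm]
      simp only [add_re, ofReal_re, mul_re, re_ofNat, im_ofNat, ofReal_im, mul_zero, sub_zero, mul_im, zero_mul,
        add_zero, I_re, I_im, mul_one, zero_add, add_im, sub_self]
      have hr0 : 0 < r := hr₁.trans hrr.1
      exact ⟨⟨Real.log_lt_log hr₁ hrr.1, Real.log_lt_log hr0 hrr.2⟩, by nlinarith [pi_pos, hθθ.1],
        by nlinarith [pi_pos, hθθ.2]⟩
    · have hr0 : 0 < r := hr₁.trans hrr.1
      rw [Complex.exp_add, ← Complex.ofReal_exp, Real.exp_log hr0]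

/-- **Polar description of the closure**: `z ∈ closure polarRect` iff `z = r e^{2πiθ}` with
`r₁ ≤ r ≤ r₂`, `θ₁ ≤ θ ≤ θ₂`. [folklore] -/
theorem mem_closure_polarRect_carrier_iff {z : ℂ} : z ∈ closure (polarRect hr₁ hr hθ hθ').carrier ↔
    ∃ r ∈ Icc r₁ r₂, ∃ θ ∈ Icc θ₁ θ₂, z = (r : ℂ) * Complex.exp (2 * π * θ * I) := by
  rw [closure_polarRect_carrier]
  constructor
  · rintro ⟨w, hw, rfl⟩
    rw [mem_reProdIm] at hw
    refine ⟨Real.exp w.re, ⟨?_, ?_⟩, w.im / (2 * π), ⟨?_, ?_⟩, ?_⟩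
    · calc r₁ = Real.exp (Real.log r₁) := (Real.exp_log hr₁).symm
        _ ≤ Real.exp w.re := Real.exp_le_exp.2 hw.1.1
    · calc Real.exp w.re ≤ Real.exp (Real.log r₂) := Real.exp_le_exp.2 hw.1.2
        _ = r₂ := Real.exp_log (hr₁.trans hr)
    · rw [le_div_iff₀ (by positivity)]; linarith [hw.2.1]
    · rw [div_le_iff₀ (by positivity)]; linarith [hw.2.2]
    · rw [exp_eq_polar]
      congr 2
      push_cast; field_simp
  · rintro ⟨r, hrr, θ, hθθ, rfl⟩
    refine ⟨Real.log r + 2 * π * θ * I, ?_, ?_⟩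
    · rw [mem_reProdIm]
      simp only [add_re, ofReal_re, mul_re, re_ofNat, im_ofNat, ofReal_im, mul_zero, sub_zero, mul_im, zero_mul,
        add_zero, I_re, I_im, mul_one, zero_add, add_im, sub_self]
      have hr0 : 0 < r := hr₁.trans_le hrr.1
      exact ⟨⟨Real.log_le_log hr₁ hrr.1, Real.log_le_log hr0 hrr.2⟩, by nlinarith [pi_pos, hθθ.1],
        by nlinarith [pi_pos, hθθ.2]⟩
    · have hr0 : 0 < r := hr₁.trans_le hrr.1
      rw [Complex.exp_add, ← Complex.ofReal_exp, Real.exp_log hr0]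

/-- The norm of a polar point `r e^{2πiθ}` (`0 ≤ r`) is `r`. [folklore] -/
theorem norm_polar {r θ : ℝ} (hr : 0 ≤ r) : ‖(r : ℂ) * Complex.exp (2 * π * θ * I)‖ = r := by
  rw [norm_mul, Complex.norm_real, Real.norm_eq_abs, abs_of_nonneg hr]
  have : (2 * π * θ * I : ℂ) = ((2 * π * θ : ℝ) : ℂ) * I := by push_cast; ring
  rw [this, Complex.norm_exp_ofReal_mul_I, mul_one]

/-- **Distance between polar points**: `‖r e^{2πiθ} - r' e^{2πiθ'}‖ ≤ |r - r'| + 2π r' |θ - θ'|`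
(`0 ≤ r'`). [folklore] -/
theorem norm_polar_sub_polar_le {r r' θ θ' : ℝ} (hr' : 0 ≤ r') :
    ‖(r : ℂ) * Complex.exp (2 * π * θ * I) - (r' : ℂ) * Complex.exp (2 * π * θ' * I)‖ ≤
      |r - r'| + 2 * π * r' * |θ - θ'| := by
  have e1 : ∀ t : ℝ, (2 * π * t * I : ℂ) = ((2 * π * t : ℝ) : ℂ) * I := fun t => by push_cast; ring
  have hn : ∀ t : ℝ, ‖Complex.exp (2 * π * t * I)‖ = 1 := fun t => by rw [e1, Complex.norm_exp_ofReal_mul_I]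
  have key : (r : ℂ) * Complex.exp (2 * π * θ * I) - (r' : ℂ) * Complex.exp (2 * π * θ' * I) =
      ((r : ℂ) - r') * Complex.exp (2 * π * θ * I) +
        (r' : ℂ) * (Complex.exp (2 * π * θ * I) - Complex.exp (2 * π * θ' * I)) := by ring
  rw [key]
  refine (norm_add_le _ _).trans (add_le_add ?_ ?_)
  · rw [norm_mul, hn, mul_one, ← Complex.ofReal_sub, Complex.norm_real, Real.norm_eq_abs]
  · rw [norm_mul, Complex.norm_real, Real.norm_eq_abs, abs_of_nonneg hr']
    have h2 : ‖Complex.exp (2 * π * θ * I) - Complex.exp (2 * π * θ' * I)‖ ≤ 2 * π * |θ - θ'| := by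
      rw [e1, e1]
      have := Real.norm_exp_I_mul_ofReal_sub_one_le (x := 2 * π * (θ - θ'))
      -- `‖e^{ia} - e^{ib}‖ = ‖e^{ib}‖ ‖e^{i(a-b)} - 1‖ ≤ |a - b|`
      have e2 : Complex.exp (((2 * π * θ : ℝ) : ℂ) * I) - Complex.exp (((2 * π * θ' : ℝ) : ℂ) * I) =
          Complex.exp (((2 * π * θ' : ℝ) : ℂ) * I) * (Complex.exp (I * ((2 * π * (θ - θ') : ℝ) : ℂ)) - 1) := by
        rw [mul_sub, mul_one, ← Complex.exp_add]
        congr 2; push_cast; ring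
      rw [e2, norm_mul, Complex.norm_exp_ofReal_mul_I, one_mul]
      refine this.trans ?_
      rw [Real.norm_eq_abs, abs_mul, abs_of_pos (by positivity : (0 : ℝ) < 2 * π)]
    calc r' * ‖Complex.exp (2 * π * θ * I) - Complex.exp (2 * π * θ' * I)‖ ≤ r' * (2 * π * |θ - θ'|) :=
          mul_le_mul_of_nonneg_left h2 hr'
      _ = 2 * π * r' * |θ - θ'| := by ring

end Polar

end Literature.Topology.PlaneTopology

end
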